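import Mathlib
import Literature.Computability.AlgebraicComplexity.ValiantClasses
import Literature.Computability.AlgebraicComplexity.ArithCircuit
import Literature.Computability.AlgebraicComplexity.SOSDecomposition
import Literature.Computability.AlgebraicComplexity.BurgisserBooleanPartsModPCircuits
import Literature.Computability.AlgebraicComplexity.ValiantCriterion
import Summits.ValiantsHypothesis.ValiantsHypothesis.Theses.FeketeSOS

/-!
# Sketch — crux-ideate stmt-ValiantsHypothesis-3995 (SOSMagnification), ideator 2, round 1

First-lemma signatures of the three idea cards (they need not be proved here; they must
elaborate). Cards: `gauss-sum-formula-witness` (A), `setmultilinear-cut-injective-kronecker`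
(B), `euler-slp-modp-simulation` (C).
-/

noncomputable section

open MvPolynomial Finset
open scoped BigOperators

namespace Summit.ValiantsHypothesis.ValiantsHypothesis.Cruxes.SOSMagnification.Sketch

open Literature.Computability.AlgebraicComplexity
open Literature.Computability.Complexity (CktSize B2)

/-! ## Common objects -/

/-- The Fekete polynomial over `ℂ` exactly as inlined in the crux. -/
def feketeC (p : ℕ) [Fact p.Prime] : Polynomial ℂ :=
  ∑ m ∈ Finset.range p, Polynomial.C ((legendreSym p m : ℤ) : ℂ) * Polynomial.X ^ m

/-- Base-`k` digit `j` of `m`. -/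
def digit (k j m : ℕ) : ℕ := m / k ^ j % k

/-- The one-hot base-`k` monomial of `m` on `n` digit blocks: `∏_{j<n} y_{j, digit_j(m)}`
(variables `Fin n × Fin k`; requires `2 ≤ k`). -/
def mon (k n : ℕ) (hk : 2 ≤ k) (m : ℕ) : MvPolynomial (Fin n × Fin k) ℂ :=
  ∏ j : Fin n, X (j, ⟨digit k j m, Nat.mod_lt _ (by omega)⟩)

/-- The base-`k` Fekete lift `P = ∑_{m<p} (m|p) · mon(m)` (DST's inverse Kronecker image of `F_p`). -/
def feketeLift (k n : ℕ) (hk : 2 ≤ k) (p : ℕ) [Fact p.Prime] : MvPolynomial (Fin n × Fin k) ℂ :=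
  ∑ m ∈ Finset.range p, C ((legendreSym p m : ℤ) : ℂ) * mon k n hk m

/-- The lift of `Ψ_p = 1 + X + ⋯ + X^{p-1}`: `LΨ = ∑_{m<p} mon(m)` (a `VP` formula by digit prefixes). -/
def psiLift (k n : ℕ) (hk : 2 ≤ k) (p : ℕ) : MvPolynomial (Fin n × Fin k) ℂ :=
  ∑ m ∈ Finset.range p, mon k n hk m

/-- The Kronecker substitution `κ : y_{j,i} ↦ X^{i·k^j}`. -/
def kron (k n : ℕ) : MvPolynomial (Fin n × Fin k) ℂ →ₐ[ℂ] Polynomial ℂ :=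
  MvPolynomial.aeval fun ji => (Polynomial.X : Polynomial ℂ) ^ ((ji.2 : ℕ) * k ^ (ji.1 : ℕ))

/-- The value of a bit vector. -/
def bitsVal {r : ℕ} (e : Fin r → Bool) : ℕ := ∑ a : Fin r, (if e a then 2 ^ (a : ℕ) else 0)

/-! ## Card A — `gauss-sum-formula-witness`: First lemma(s) -/

/-- The quadratic Gauss sum `G_p = ∑_x e(x²/p)` as a complex number. -/
def qGauss (p : ℕ) [NeZero p] : ℂ := ∑ x : ZMod p, (ZMod.stdAddChar (N := p) (x ^ 2) : ℂ)

/-- **A1 (Gauss inversion of the Legendre symbol).** For an odd prime `p` and every residue `m`: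
`∑_x e(m x²/p) = (m|p)·G_p + p·[m = 0]`, with `G_p² = (−1|p)·p ≠ 0`
(Mathlib: `quadraticChar_card_sqrts`, `gaussSum_mulShift`, `gaussSum_sq`;
`legendreSym p m = quadraticChar (ZMod p) m` by definition). -/
theorem firstLemma_A1 (p : ℕ) [Fact p.Prime] (hp : p ≠ 2) (m : ZMod p) :
((∑ x : ZMod p, (ZMod.stdAddChar (N := p) (m * x ^ 2) : ℂ)) =
        ((legendreSym p (m.val : ℤ) : ℤ) : ℂ) * qGauss p + (if m = 0 then (p : ℂ) else 0)) ∧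
      (qGauss p ^ 2 = ((legendreSym p (-1) : ℤ) : ℂ) * p ∧ qGauss p ≠ 0) := by
  sorry

/-- **A2 (Gauss inversion of the Fekete polynomial, univariate form).**
`F_p(X) = G_p⁻¹ · ∑_{x ∈ ℤ/p} Ψ_p(e(x²/p)·X) − p·G_p⁻¹`, `Ψ_p(Y) = ∑_{m<p} Y^m`: the Legendre
coefficient becomes a GEOMETRIC weight `e(x²/p)^m` summed over a cube. -/
theorem firstLemma_A2 (p : ℕ) [Fact p.Prime] (hp : p ≠ 2) :
    feketeC p =
      Polynomial.C (qGauss p)⁻¹ *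
          (∑ x : ZMod p, ∑ m ∈ Finset.range p,
            Polynomial.C ((ZMod.stdAddChar (N := p) (x ^ 2) : ℂ) ^ m) * Polynomial.X ^ m) -
        Polynomial.C ((p : ℂ) * (qGauss p)⁻¹) := by
  sorry

/-- **A3 (roots of unity of a quadratic form in bits are a product formula).** For `ψ` an additive
character of `ZMod p`, a residue `c` and Boolean `e ∈ {0,1}^r` with value `v = ∑ e_a 2^a`:
`ψ(c·v²) = ∏_{a,b} (1 + (ψ(c·2^{a+b}) − 1)·e_a e_b)` — i.e. the Boolean evaluation of the
size-`O(r²)` FORMULA `W_c = ∏_{a,b} (1 + C(ψ(c 2^{a+b}) − 1)·E_a E_b)`. -/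
theorem firstLemma_A3 (p : ℕ) [NeZero p] (ψ : AddChar (ZMod p) ℂ) (c : ZMod p) (r : ℕ)
    (e : Fin r → Bool) :
    MvPolynomial.eval (fun a : Fin r => if e a then (1 : ℂ) else 0)
        (∏ a : Fin r, ∏ b : Fin r,
          (1 + C (ψ (c * 2 ^ ((a : ℕ) + (b : ℕ))) - 1) * X a * X b)) =
      ψ (c * ((bitsVal e : ℕ) : ZMod p) ^ 2) := by
  sorry

/-- **A4 (the VNP statement the card delivers).** For `2 ≤ k` and ANY sequence of odd primes
`pr n ≤ k^n`, the base-`k` Fekete lifts form a `VNP` family over `ℂ` — witnessed by the explicit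
formula `g_n(y,e) = G⁻¹·[e < p]·LΨ_p((W_{i k^j}(e)·y_{j,i})_{j,i}) − p G⁻¹·mon(0)·∏_a(1 − e_a)`
(Bürgisser Def. 2.5 literally: `IsVNPFamily` = Boolean sum of a `VP` family). -/
theorem firstLemma_A4 (k : ℕ) (hk : 2 ≤ k) (pr : ℕ → ℕ) (hpr : ∀ n, (pr n).Prime)
    (hodd : ∀ n, pr n ≠ 2) (hle : ∀ n, pr n ≤ k ^ n) :
    IsVNPFamily (k := ℂ) (σ := fun n => Fin n × Fin k)
      (fun n => @feketeLift k n hk (pr n) ⟨hpr n⟩) := by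
  sorry

/-! ## Card B — `setmultilinear-cut-injective-kronecker`: First lemma(s) -/

/-- A monomial `d` on `Fin n × Fin k` is *block-set-multilinear on `S`*: degree exactly one in
every digit block `j ∈ S`, untouched blocks outside `S`. -/
def IsSML {n k : ℕ} (S : Finset (Fin n)) (d : Fin n × Fin k →₀ ℕ) : Prop :=
  (∀ j ∈ S, ∑ i : Fin k, d (j, i) = 1) ∧ ∀ j ∉ S, ∀ i : Fin k, d (j, i) = 0

open Classical in
/-- The set-multilinear projection `π_S` (keep exactly the `S`-block-set-multilinear monomials). -/
def smlProj {n k : ℕ} (S : Finset (Fin n)) (g : MvPolynomial (Fin n × Fin k) ℂ) :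
    MvPolynomial (Fin n × Fin k) ℂ :=
  ∑ d ∈ g.support.filter (fun d => IsSML S d), monomial d (coeff d g)

/-- **B1 (projected product formula — the lever).** The full set-multilinear part of a product is
the sum over block-splits of the products of the partial projections:
`π_[n](g·h) = ∑_S π_S(g) · π_{Sᶜ}(h)`. With `deg g ≤ D`, `deg h ≤ n − D` only `|S| = D` survive,
so the tree's degree cut `P = ∑ gℓ hℓ` (`exists_bilin_of_two_le_totalDegree`) becomes an EXACT
block-separated decomposition of the (set-multilinear) Fekete lift. -/
theorem firstLemma_B1 {n k : ℕ} (g h : MvPolynomial (Fin n × Fin k) ℂ) :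
    smlProj Finset.univ (g * h) = ∑ S : Finset (Fin n), smlProj S g * smlProj Sᶜ h := by
  sorry

/-- **B2 (Kronecker is injective on block-set-multilinear monomials).** Base-`k` digit uniqueness:
`κ(π_S g)` has at most `k^{|S|}` monomials and degree `< k^n` — no binomial entropy loss and no use
of the crux's `deg ≤ p²` slack. -/
theorem firstLemma_B2 {n k : ℕ} (hk : 2 ≤ k) (S : Finset (Fin n))
    (g : MvPolynomial (Fin n × Fin k) ℂ) :
    (kron k n (smlProj S g)).support.card ≤ k ^ S.card ∧
      (kron k n (smlProj S g)).natDegree < k ^ n := by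
  sorry

/-- **B3 (the lift is fixed by `π_[n]` and maps to `F_p`).** -/
theorem firstLemma_B3 (k n : ℕ) (hk : 2 ≤ k) (p : ℕ) [Fact p.Prime] (hp : p ≤ k ^ n) :
    smlProj Finset.univ (feketeLift k n hk p) = feketeLift k n hk p ∧
      kron k n (feketeLift k n hk p) = feketeC p := by
  sorry

/-- **B4 (the cheap SOS representation, contradicting the crux's hypothesis).** From a bilinear
degree cut with `T` terms: an SOS representation of `F_p` with `s ≤ 2·T·2^n` squares, each of
sparsity `≤ 2·k^{⌈n/2⌉}` and degree `< k^n`. -/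
theorem firstLemma_B4 (k n : ℕ) (hk : 2 ≤ k) (p : ℕ) [Fact p.Prime] (hp : p ≤ k ^ n) (T : ℕ)
    (L : List (MvPolynomial (Fin n × Fin k) ℂ × MvPolynomial (Fin n × Fin k) ℂ))
    (hL : L.length ≤ T)
    (hdeg : ∀ gh ∈ L, gh.1.totalDegree ≤ (n + 1) / 2 ∧ gh.2.totalDegree ≤ n - (n + 1) / 2)
    (hsum : (L.map fun gh => gh.1 * gh.2).sum = feketeLift k n hk p) :
    ∃ (s : ℕ) (c : Fin s → ℂ) (g : Fin s → Polynomial ℂ),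
      s ≤ 2 * T * 2 ^ n ∧ (∀ i, (g i).natDegree < k ^ n) ∧
        (∀ i, (g i).support.card ≤ 2 * k ^ ((n + 1) / 2)) ∧
          (∑ i, Polynomial.C (c i) * g i ^ 2) = feketeC p := by
  sorry

/-! ## Card C — `euler-slp-modp-simulation`: First lemma(s) -/

/-- **C1 (Euler's criterion through the tree's mod-`p` Boolean simulator).** The `ℓ` bits of
`m^{(p−1)/2} mod p`, as a function of the `ℓ` bits of `m < 2^ℓ` (`p ≤ 2^ℓ`), have `B₂`-circuits
of size polynomial in `ℓ`: feed the repeated-squaring straight-line program for `x^{(p-1)/2}`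
(an `ArithCircuit ℤ Unit` of size `≤ 2ℓ`) to `cktSize_testBits_aeval_eval`. -/
theorem firstLemma_C1 : ∃ c : ℕ, ∀ (p ℓ : ℕ) [Fact p.Prime], p ≤ 2 ^ ℓ →
    CktSize B2 (fun e : Fin ℓ → Bool => testBits ℓ (((bitsVal e : ℕ) : ZMod p) ^ (p / 2)).val)
      ((ℓ + 2) ^ c) := by
  sorry

/-- **C2 (one-hot codes make `circuitSum`'s monomial selector exact).** With `k = 2^ℓ₀` the lift
is a difference of two `circuitSum`s (`ValiantCriterion.circuitSum`) over the `kn` cube: the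
`0/1` coefficient functions `[e = onehot(m), m < p, (m|p) = ±1]`. -/
theorem firstLemma_C2 (k : ℕ) (hk : 2 ≤ k) (pr : ℕ → ℕ) (hpr : ∀ n, (pr n).Prime)
    (hle : ∀ n, pr n ≤ k ^ n) :
    ∃ (Qp Qm : ∀ n, Literature.Computability.Complexity.Circuit (Fin (n * k))),
      (∀ n, (Qp n).IsOver B2) ∧ (∀ n, (Qm n).IsOver B2) ∧
      IsPBounded (fun n => (Qp n).size) ∧ IsPBounded (fun n => (Qm n).size) ∧
      ∀ n, MvPolynomial.rename (finProdFinEquiv) (@feketeLift k n hk (pr n) ⟨hpr n⟩) =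
        ValiantCriterion.circuitSum (k := ℂ) (Qp n) - ValiantCriterion.circuitSum (k := ℂ) (Qm n) := by
  sorry

end Summit.ValiantsHypothesis.ValiantsHypothesis.Cruxes.SOSMagnification.Sketch
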